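import Mathlib
import Summits.CriticalPhenomena.Ising3DConformalLimit.Theorems.HyperoctahedralRPCriticalCorrNineMirrorRP
import Summits.CriticalPhenomena.Ising3DConformalLimit.Theorems.HyperoctahedralRPTwoPointKernelOfLimit
import Literature.Probability.LatticeModels.HighDimPointwiseTriviality

/-!
# Crux `CriticalTwoPointGSM`, line `Sketch` (canonical-lift spine): closed two-point nine-mirror
# reflection positivity

Route `GaussianScaleMixture` of `Ising3DConformalLimit`, crux `CriticalTwoPointGSM`
(stmt-CriticalPhenomena-8365), line `Sketch`, canonical-lift spine (seat c1), stub
`nineMirror_closedRP_two` — the nine-direction dividend feeding the diagonal Källén–Lehmann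
representations (`diagConsForm_hausdorff`).

Write `G(v) = ⟨σ₀ σ_v⟩⁺_{β_c}` (`criticalTwoPoint 3 v`) for the critical two-point function of the
nearest-neighbour Ising model on `ℤ³`. For each of the nine site mirrors `θ` of `ℤ³` through the
origin — the coordinate planes `x_i = 0` (`θ` negates `x_i`, level `ℓ = x_i`), the diagonal planes
`x_i = x_j` (`θ` swaps `x_i, x_j`, `ℓ = x_i - x_j`) and the anti-diagonal planes `x_i = -x_j`
(`θ : x_i ↦ -x_j, x_j ↦ -x_i`, `ℓ = x_i + x_j`) — finitely many sites `y_a` (indexed by an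
arbitrary finite type) in the CLOSED half `{ℓ ≥ 0}` and real coefficients `c_a`:

`0 ≤ ∑_{a,b} c_a c_b G(y_b - θ y_a)`.

This is the two-point (all clusters of size one), closed-half-space form of the reflection
positivity in planes through sites of Fröhlich–Israel–Lieb–Simon (Comm. Math. Phys. 62 (1978),
§3 Thm. 3.1). The tree proves the closed multi-cluster version for a general level mirror,
`HyperoctahedralRPNineMirror.criticalCorr_levelMirror_rp`; the three mirror families are checked to
satisfy its hypotheses exactly as in `HyperoctahedralRPNineMirror.criticalCorrNineMirrorRP_proof`
(`levelMirror_rp_of_nine`), the clusters are specialised to singletons and the pair correlator is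
converted to the two-point function by `HyperoctahedralRPTwoPoint.append_one_one` and
`criticalCorr_two_pair` (`closedRP_two_fin`), and finally the index type `Fin m` is replaced by an
arbitrary `Fintype` through `Fintype.equivFin`.

Contents: helpers in `CriticalTwoPointGSMJs.NineMirrorClosedRPTwo`, then the registered stub
`nineMirror_closedRP_two`. No definitions are introduced.
-/

namespace Summit.CriticalPhenomena.Ising3DConformalLimit.Theorems

open MeasureTheory Filter Topology
open Literature.Probability.LatticeModels
open scoped BigOperators

noncomputable section

namespace CriticalTwoPointGSMJs.NineMirrorClosedRPTwo

open Literature.Probability.Percolation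
open Summit.CriticalPhenomena.Ising3DConformalLimit.Cruxes.InversionUpgradeNormalised.FreeEndpointGaussianClosure
open Summit.CriticalPhenomena.Ising3DConformalLimit.HyperoctahedralRPNineMirror

/-! ## The closed multi-cluster nine-mirror reflection positivity -/

/-- **Closed nine-mirror reflection positivity of the critical correlators.** For each of the nine
site mirrors `(θ, ℓ)` of `ℤ³` through the origin, finitely many lattice configurations `z^a` in the
CLOSED half `{ℓ ≥ 0}` and real coefficients `c_a`,
`0 ≤ Σ_{a,b} c_a c_b ⟨∏ σ_{θ z^a ++ z^b}⟩_{β_c}`: each mirror is an involutive automorphism of the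
nearest-neighbour graph with `ℓ ∘ θ = -ℓ`, `θ = id` on `{ℓ = 0}`, `|Δℓ| ≤ 1` along edges and the
centred boxes `θ`-stable, so `criticalCorr_levelMirror_rp` applies (the case analysis of
`criticalCorrNineMirrorRP_proof`, with the closed hypothesis).
[cite: FrohlichEtAl1978, §3 Thm 3.1] -/
theorem levelMirror_rp_of_nine (θ' : Site 3 → Site 3) (ℓ : Site 3 → ℤ)
    (hθℓ : ∃ i j : Fin 3, i ≠ j ∧ ((θ' = fun x => Function.update x i (-x i)) ∧ (ℓ = fun x => x i) ∨
      (θ' = fun x => x ∘ Equiv.swap i j) ∧ (ℓ = fun x => x i - x j) ∨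
      (θ' = fun x => Function.update (Function.update x i (-x j)) j (-x i)) ∧
        (ℓ = fun x => x i + x j)))
    (m : ℕ) (k : Fin m → ℕ) (z : (a : Fin m) → Fin (k a) → Site 3) (c : Fin m → ℝ)
    (hz : ∀ a l, 0 ≤ ℓ (z a l)) :
    0 ≤ ∑ a, ∑ b, c a * c b *
      criticalCorr 3 (k a + k b) (Fin.append (fun l => θ' (z a l)) (z b)) := by
  obtain ⟨i, j, hij, ⟨rfl, rfl⟩ | ⟨rfl, rfl⟩ | ⟨rfl, rfl⟩⟩ := hθℓ
  · -- coordinate mirror `x_i ↦ -x_i`, level `x_i`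
    refine criticalCorr_levelMirror_rp _ (mirror_involutive i) (fun x y h => mirror_adj i h)
      (fun x => x i) (fun x => by simp) (fun x hx0 => ?_) (fun x y h => apply_le_add_one_of_adj i h)
      (fun L x => mem_box_iff_mirror_mem_box i L x) m k z c hz
    have hx0' : x i = 0 := hx0
    rw [hx0', neg_zero, ← hx0', Function.update_eq_self]
  · -- diagonal mirror (swap), level `x_i - x_j`
    refine criticalCorr_levelMirror_rp _ (swapMirror_involutive i j) (fun x y h => ?_)
      (fun x => x i - x j) (fun x => ?_) (fun x hx0 => ?_)
      (fun x y h => sub_le_add_one_of_adj i j h) (fun L x => ?_) m k z c hz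
    · have h' := zdGraph_adj_signedPerm (Equiv.swap i j) 1 h
      rw [← swapMirror_eq_signedPerm] at h'
      exact h'
    · simp [Equiv.swap_apply_left, Equiv.swap_apply_right]
    · have hx0' : x i - x j = 0 := hx0
      funext l
      simp only [Function.comp_apply]
      by_cases hli : l = i
      · subst hli; rw [Equiv.swap_apply_left]; omega
      · by_cases hlj : l = j
        · subst hlj; rw [Equiv.swap_apply_right]; omega
        · rw [Equiv.swap_apply_of_ne_of_ne hli hlj]
    · have h' := (signedPerm_mem_box_iff (Equiv.swap i j) 1 (n := L) (x := x)).symm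
      rw [← swapMirror_eq_signedPerm] at h'
      exact h'
  · -- anti-diagonal mirror, level `x_i + x_j`
    refine criticalCorr_levelMirror_rp _ (antiMirror_involutive hij) (fun x y h => ?_)
      (fun x => x i + x j) (fun x => ?_) (fun x hx0 => ?_)
      (fun x y h => add_le_add_one_of_adj hij h) (fun L x => ?_) m k z c hz
    · have h' := zdGraph_adj_signedPerm (Equiv.swap i j)
        (fun l => if l = i ∨ l = j then -1 else 1) h
      rw [← antiMirror_eq_signedPerm hij] at h'
      exact h'
    · simp [Function.update_of_ne hij, add_comm]
    · have hx0' : x i + x j = 0 := hx0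
      funext l
      by_cases hlj : l = j
      · subst hlj
        rw [Function.update_self]
        omega
      · by_cases hli : l = i
        · subst hli
          rw [Function.update_of_ne hlj, Function.update_self]
          omega
        · rw [Function.update_of_ne hlj, Function.update_of_ne hli]
    · have h' := (signedPerm_mem_box_iff (Equiv.swap i j)
        (fun l => if l = i ∨ l = j then -1 else 1) (n := L) (x := x)).symm
      rw [← antiMirror_eq_signedPerm hij] at h'
      exact h'

/-! ## Singleton clusters: the two-point form on `Fin m` -/

/-- **Closed two-point nine-mirror reflection positivity, `Fin m`-indexed.** For each of the nine
site mirrors `(θ, ℓ)`, sites `y_a ∈ {ℓ ≥ 0}` (`a : Fin m`) and real `c_a`: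
`0 ≤ Σ_{a,b} c_a c_b G(y_b - θ y_a)` — `levelMirror_rp_of_nine` with all clusters of size one, and
`⟨σ_{θ y_a} σ_{y_b}⟩_{β_c} = G(y_b - θ y_a)` (`HyperoctahedralRPTwoPoint.append_one_one`,
`criticalCorr_two_pair`).
[cite: FrohlichEtAl1978, §3 Thm 3.1] -/
theorem closedRP_two_fin (θ' : Site 3 → Site 3) (ℓ : Site 3 → ℤ)
    (hθℓ : ∃ i j : Fin 3, i ≠ j ∧ ((θ' = fun x => Function.update x i (-x i)) ∧ (ℓ = fun x => x i) ∨
      (θ' = fun x => x ∘ Equiv.swap i j) ∧ (ℓ = fun x => x i - x j) ∨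
      (θ' = fun x => Function.update (Function.update x i (-x j)) j (-x i)) ∧
        (ℓ = fun x => x i + x j)))
    (m : ℕ) (y : Fin m → Site 3) (c : Fin m → ℝ) (hy : ∀ a, 0 ≤ ℓ (y a)) :
    0 ≤ ∑ a, ∑ b, c a * c b * criticalTwoPoint 3 (y b - θ' (y a)) := by
  have h := levelMirror_rp_of_nine θ' ℓ hθℓ m (fun _ => 1) (fun a _ => y a) c (fun a _ => hy a)
  have hconv : ∀ a b, criticalCorr 3 (1 + 1)
      (Fin.append (fun _ : Fin 1 => θ' (y a)) (fun _ : Fin 1 => y b)) =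
      criticalTwoPoint 3 (y b - θ' (y a)) := fun a b => by
    rw [HyperoctahedralRPTwoPoint.append_one_one, ← criticalCorr_two_pair]
  simpa only [hconv] using h

end CriticalTwoPointGSMJs.NineMirrorClosedRPTwo

open CriticalTwoPointGSMJs.NineMirrorClosedRPTwo in
/-- **Closed-half-space two-point nine-mirror reflection positivity of the critical `ℤ³` Ising
two-point function** (stub `nineMirror_closedRP_two` of the canonical-lift spine). For each of the
nine site mirrors `θ` of `ℤ³` through the origin — coordinate plane `x_i = 0` (level `x_i`),
diagonal plane `x_i = x_j` (level `x_i - x_j`), anti-diagonal plane `x_i = -x_j` (level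
`x_i + x_j`) — finitely many sites `y_a` in the closed half `{ℓ ≥ 0}` indexed by any finite type
and real coefficients `c_a`: `0 ≤ Σ_{a,b} c_a c_b ⟨σ₀ σ_{y_b - θ y_a}⟩⁺_{β_c}`. Reflection
positivity in planes through sites (FILS 1978 §3 Thm. 3.1; the tree's
`criticalCorr_levelMirror_rp`), two-point case, transported along `Fintype.equivFin`.
[cite: FrohlichEtAl1978, §3 Thm 3.1] -/
theorem nineMirror_closedRP_two : ∀ (θ' : Site 3 → Site 3) (ℓ : Site 3 → ℤ),
    (∃ i j : Fin 3, i ≠ j ∧ ((θ' = fun x => Function.update x i (-x i)) ∧ (ℓ = fun x => x i) ∨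
      (θ' = fun x => x ∘ Equiv.swap i j) ∧ (ℓ = fun x => x i - x j) ∨
      (θ' = fun x => Function.update (Function.update x i (-x j)) j (-x i)) ∧ (ℓ = fun x => x i + x j))) →
    ∀ (ι : Type) [Fintype ι] (y : ι → Site 3) (c : ι → ℝ), (∀ a, 0 ≤ ℓ (y a)) →
      0 ≤ ∑ a, ∑ b, c a * c b * criticalTwoPoint 3 (y b - θ' (y a)) := by
  intro θ' ℓ hθℓ ι _ y c hy
  let e : ι ≃ Fin (Fintype.card ι) := Fintype.equivFin ι
  have h := closedRP_two_fin θ' ℓ hθℓ (Fintype.card ι) (fun a => y (e.symm a))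
    (fun a => c (e.symm a)) (fun a => hy (e.symm a))
  calc (0 : ℝ) ≤ ∑ a, ∑ b, c (e.symm a) * c (e.symm b) *
      criticalTwoPoint 3 (y (e.symm b) - θ' (y (e.symm a))) := h
    _ = ∑ a, ∑ b, c a * c b * criticalTwoPoint 3 (y b - θ' (y a)) := by
      refine (Fintype.sum_equiv e _ _ fun a => Fintype.sum_equiv e _ _ fun b => ?_).symm
      simp only [Equiv.symm_apply_apply]

end

end Summit.CriticalPhenomena.Ising3DConformalLimit.Theorems
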